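import Summits.AtomisticToContinuum.FouriersLaw.Theorems.BondHeatUncertaintyBoundedResponseParitySectorSplitA
import HarnessLib

/-!
# BondHeatUncertainty / BoundedResponse — «ParitySectorSplit» (lens-1 g101 NODE): part 2 of 3 (sequel of `…BondHeatUncertaintyBoundedResponseParitySectorSplitA`; the module docstring of part 1 `…ParitySectorSplitA` describes the node)

Split for the 400-line cap by the landing lane (hand-2 g37).  This part: §2b the even-sector scalar as the FIRST MOMENT of the boundary kernel, §3 the two sectors as graded statements and the exact split of (C_s) (incl. the three `def … : Prop`).
Same namespace, section, opens and variables; all FQNs unchanged; bodies verbatim.  0 sorry; standard axioms.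
-/

noncomputable section

open MeasureTheory ProbabilityTheory Filter Topology Set Function
open scoped NNReal ENNReal
open Literature.MathematicalPhysics.KineticTheory.HeatConduction
open Literature.MathematicalPhysics.KineticTheory OscillatorChain
open Summit.AtomisticToContinuum.FouriersLaw.Theorems.SubdiffusiveBondHeat
open Summit.AtomisticToContinuum.FouriersLaw.Theorems.OddSectorIrreversibility
open Summit.AtomisticToContinuum.FouriersLaw.Theorems.BoundedResponse.TransientBand
open Summit.AtomisticToContinuum.FouriersLaw.Cruxes.SuperadditiveResistance.FloatingProbeBypassLaplacian
  (integral_flip_gibbsMeasure integrable_flip_gibbsMeasure measurePreserving_flip_gibbsMeasure)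

namespace Summit.AtomisticToContinuum.FouriersLaw.Theorems.BoundedResponse.ParityFloor

open Summit.AtomisticToContinuum.FouriersLaw.Theses.BondHeatUncertainty (BoundedResponse)
open Summit.AtomisticToContinuum.FouriersLaw.Theorems.BoundedResponse.TransientBand (TransientCeilingPoint)
open Summit.AtomisticToContinuum.FouriersLaw.Theorems.SubdiffusiveBondHeat.EscapeGrading (CurrentCorrectorBudget)

section ParitySectorSplit

variable {ω₂ lam β γ T : ℝ} {N : ℕ}

/-! ## §2b The even-sector scalar is the FIRST MOMENT of the boundary kernel: `⟨h₀∘Θ, h₀⟩ = ∫₀^∞ u·K_N(u) du` -/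

/-- **Exponential decay of the boundary kernel at fixed `N ≥ 1`**: `|K_N(u)| ≤ D·e^{−cu}` for `u ≥ 0`, with
`D = K(2/ϑ+T)·∫ |θ₀| e^{ϑH} dμ_T`, `ϑ = 1/(4T)` (`K_N(u) = ⟨θ₀, P_uθ₀⟩`, the Harris bound on `P_uθ₀`, tree
`kinAct_integrableOn`). [folklore] -/
theorem abs_escapeKernel_le_exp (hω : 0 < ω₂) (hl : 0 < lam) (hβ : 0 < β) (hγ : 0 < γ) (hN : 0 < N) (hT : 0 < T) :
    ∃ D c : ℝ, 0 ≤ D ∧ 0 < c ∧ ∀ u : ℝ, 0 ≤ u → |escapeKernel ω₂ lam β γ T N u| ≤ D * Real.exp (-c * u) := by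
  set P := pinnedChain ω₂ lam β γ with hP
  obtain ⟨hϑ0, h2ϑ, hϑ1⟩ := weight_facts hT
  obtain ⟨K, c, hK, hc, hb⟩ := harrisBound_exists hω hl.le hβ hγ hN hT hϑ0 hϑ1
  obtain ⟨hθm, hθ2⟩ := kinObs_sq_facts hω hl.le hβ hγ hN hT ⟨0, hN⟩
  set μT := P.gibbsMeasure N T with hμT
  have hν : Integrable (fun y => Real.exp (2 * (1 / (4 * T)) * P.hamiltonian N y)) μT :=
    pinnedChain_integrable_exp_mul_hamiltonian_gibbsMeasure hω hl.le hβ.le γ N hT h2ϑ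
  have hHc : Continuous (P.hamiltonian N) := pinnedChain_continuous_hamiltonian ω₂ lam β γ N
  -- the weight `|θ₀|·e^{ϑH} ∈ L¹(μ_T)` (AM–GM against `θ₀², e^{2ϑH} ∈ L¹`)
  set Wt : PhaseSpace N → ℝ := fun z => |kinObs T N ⟨0, hN⟩ z| * Real.exp (1 / (4 * T) * P.hamiltonian N z) with hWt
  have hWi : Integrable Wt μT := by
    refine ((hθ2.add hν).div_const 2).mono'
      (hθm.aestronglyMeasurable.norm.mul (Real.continuous_exp.comp (continuous_const.mul hHc)).aestronglyMeasurable)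
      (Eventually.of_forall fun z => ?_)
    have hE2 : Real.exp (2 * (1 / (4 * T)) * P.hamiltonian N z) = Real.exp (1 / (4 * T) * P.hamiltonian N z) ^ 2 := by
      rw [← Real.exp_nat_mul]; ring_nf
    rw [Real.norm_eq_abs, abs_of_nonneg (mul_nonneg (abs_nonneg _) (Real.exp_pos _).le), Pi.add_apply, hE2]
    nlinarith [sq_nonneg (|kinObs T N ⟨0, hN⟩ z| - Real.exp (1 / (4 * T) * P.hamiltonian N z)),
      sq_abs (kinObs T N ⟨0, hN⟩ z)]
  have hW0 : 0 ≤ ∫ z, Wt z ∂μT := integral_nonneg fun z => mul_nonneg (abs_nonneg _) (Real.exp_pos _).le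
  refine ⟨K * (2 / (1 / (4 * T)) + T) * ∫ z, Wt z ∂μT, c, by positivity, hc, fun u hu => ?_⟩
  have hKu : escapeKernel ω₂ lam β γ T N u =
      ∫ z, kinObs T N ⟨0, hN⟩ z * kinAct ω₂ lam β γ T N ⟨0, hN⟩ u z ∂μT := by
    rw [escapeKernel_of_pos hN]; rfl
  have hpt : ∀ z : PhaseSpace N, ‖kinObs T N ⟨0, hN⟩ z * kinAct ω₂ lam β γ T N ⟨0, hN⟩ u z‖ ≤
      K * (2 / (1 / (4 * T)) + T) * Real.exp (-c * u) * Wt z := fun z => by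
    rw [norm_mul, Real.norm_eq_abs, Real.norm_eq_abs]
    have h := (kinAct_integrableOn hω hl.le hβ hγ hT hϑ0 hb hc ⟨0, hN⟩ z).2 u hu
    calc |kinObs T N ⟨0, hN⟩ z| * |kinAct ω₂ lam β γ T N ⟨0, hN⟩ u z|
        ≤ |kinObs T N ⟨0, hN⟩ z| * (K * (2 / (1 / (4 * T)) + T) *
            Real.exp (1 / (4 * T) * P.hamiltonian N z) * Real.exp (-c * u)) :=
          mul_le_mul_of_nonneg_left h (abs_nonneg _)
      _ = K * (2 / (1 / (4 * T)) + T) * Real.exp (-c * u) * Wt z := by simp only [hWt]; ring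
  have h1 := norm_integral_le_of_norm_le (hWi.const_mul (K * (2 / (1 / (4 * T)) + T) * Real.exp (-c * u)))
    (Eventually.of_forall hpt)
  rw [integral_const_mul, Real.norm_eq_abs] at h1
  rw [hKu]
  calc |∫ z, kinObs T N ⟨0, hN⟩ z * kinAct ω₂ lam β γ T N ⟨0, hN⟩ u z ∂μT|
      ≤ K * (2 / (1 / (4 * T)) + T) * Real.exp (-c * u) * ∫ z, Wt z ∂μT := h1
    _ = K * (2 / (1 / (4 * T)) + T) * (∫ z, Wt z ∂μT) * Real.exp (-c * u) := by ring

/-- ★ **`lim_{t→∞} Ov_N(t) = (γ/T²)∫₀^∞ u·K_N(u) du`** — the escape transient `(γ/T²)∫ min(u,t) K_N(u) du` (its DEFINITION)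
converges to the FIRST MOMENT of the boundary kernel (dominated convergence on `(0,∞)` under `u·D·e^{−cu} ≤ (2D/c)e^{−cu/2}`).
[folklore] -/
theorem tendsto_escapeTransient_atTop_moment (hω : 0 < ω₂) (hl : 0 < lam) (hβ : 0 < β) (hγ : 0 < γ) (hN : 0 < N)
    (hT : 0 < T) :
    Tendsto (escapeTransient ω₂ lam β γ T N) atTop
      (𝓝 (γ / T ^ 2 * ∫ u in Ioi 0, u * escapeKernel ω₂ lam β γ T N u)) := by
  obtain ⟨D, c, hD, hc, hKexp⟩ := abs_escapeKernel_le_exp hω hl hβ hγ hN hT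
  have hKc := continuous_escapeKernel hω hl hβ hγ hT N
  have hc2 : 0 < c / 2 := by positivity
  set B : ℝ → ℝ := fun u => 2 * D / c * Real.exp (-(c / 2) * u) with hB
  have hBi : IntegrableOn B (Ioi 0) := (exp_neg_integrableOn_Ioi 0 hc2).const_mul _
  have hdom : ∀ t : ℝ, 0 ≤ t → ∀ u ∈ Ioi (0 : ℝ), ‖min u t * escapeKernel ω₂ lam β γ T N u‖ ≤ B u := by
    intro t ht u hu
    have hu0 : 0 < u := hu
    rw [norm_mul, Real.norm_eq_abs, Real.norm_eq_abs, abs_of_nonneg (le_min hu0.le ht)]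
    have h1 : min u t * |escapeKernel ω₂ lam β γ T N u| ≤ u * (D * Real.exp (-c * u)) :=
      mul_le_mul (min_le_left _ _) (hKexp u hu0.le) (abs_nonneg _) hu0.le
    have h2 : u ≤ 2 / c * Real.exp (c / 2 * u) := by
      have h := Real.add_one_le_exp (c / 2 * u)
      rw [div_mul_eq_mul_div, le_div_iff₀ hc]
      nlinarith
    have h3 : u * (D * Real.exp (-c * u)) ≤ 2 / c * Real.exp (c / 2 * u) * (D * Real.exp (-c * u)) :=
      mul_le_mul_of_nonneg_right h2 (by positivity)
    have e : 2 / c * Real.exp (c / 2 * u) * (D * Real.exp (-c * u)) = B u := by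
      simp only [hB]
      rw [show -(c / 2) * u = c / 2 * u + -c * u by ring, Real.exp_add]
      ring
    linarith
  have h := tendsto_integral_filter_of_dominated_convergence (μ := volume.restrict (Ioi (0 : ℝ))) (l := atTop)
    (F := fun (t u : ℝ) => min u t * escapeKernel ω₂ lam β γ T N u)
    (f := fun u => u * escapeKernel ω₂ lam β γ T N u) B
    (Eventually.of_forall fun t => ((continuous_id.min continuous_const).mul hKc).aestronglyMeasurable)
    (by
      filter_upwards [eventually_ge_atTop (0 : ℝ)] with t ht
      exact (ae_restrict_iff' measurableSet_Ioi).2 (Eventually.of_forall (hdom t ht)))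
    hBi
    ((ae_restrict_iff' measurableSet_Ioi).2 (Eventually.of_forall fun u _ => by
      refine (tendsto_const_nhds (x := u * escapeKernel ω₂ lam β γ T N u)).congr' ?_
      filter_upwards [eventually_ge_atTop u] with t ht
      rw [min_eq_left ht]))
  exact h.const_mul (γ / T ^ 2)

/-- ★ **GREEN–KUBO FORM OF THE EVEN SECTOR: `⟨h₀∘Θ, h₀⟩_{μ_T} = ∫₀^∞ u·K_N(u) du`** (uniqueness of the limit of `Ov_N`:
`tendsto_escapeTransient_atTop` and `tendsto_escapeTransient_atTop_moment`).  With §1: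
`‖h₀‖² = ∫₀^∞ u·K_N(u) du + ½·oddDefect(μ_T) h₀`. [folklore] -/
theorem flip_pairing_eq_kernelMoment (hω : 0 < ω₂) (hl : 0 < lam) (hβ : 0 < β) (hγ : 0 < γ) (hN : 0 < N) (hT : 0 < T) :
    ∫ z, kinCorrector ω₂ lam β γ T N ⟨0, hN⟩ (z.1, -z.2) * kinCorrector ω₂ lam β γ T N ⟨0, hN⟩ z
        ∂((pinnedChain ω₂ lam β γ).gibbsMeasure N T) =
      ∫ u in Ioi 0, u * escapeKernel ω₂ lam β γ T N u := by
  have h3 := tendsto_nhds_unique (tendsto_escapeTransient_atTop hω hl hβ hγ hN hT)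
    (tendsto_escapeTransient_atTop_moment hω hl hβ hγ hN hT)
  have hγT : γ / T ^ 2 ≠ 0 := by positivity
  exact mul_left_cancel₀ hγT h3

/-- **`‖h₀‖²_{μ_T} = ∫₀^∞ u·K_N(u) du + ½·oddDefect(μ_T) h₀`** — the corrector norm (the leaf (C₁)'s quantity) split into
the kernel's first moment (EVEN sector) and the odd defect (ODD sector). [folklore] -/
theorem correctorSq_eq_kernelMoment_add_oddDefect (hω : 0 < ω₂) (hl : 0 < lam) (hβ : 0 < β) (hγ : 0 < γ) (hN : 0 < N)
    (hT : 0 < T) :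
    ∫ z, kinCorrector ω₂ lam β γ T N ⟨0, hN⟩ z ^ 2 ∂((pinnedChain ω₂ lam β γ).gibbsMeasure N T) =
      (∫ u in Ioi 0, u * escapeKernel ω₂ lam β γ T N u) +
        oddDefect ((pinnedChain ω₂ lam β γ).gibbsMeasure N T) (kinCorrector ω₂ lam β γ T N ⟨0, hN⟩) / 2 := by
  obtain ⟨h0m, h02, -, -⟩ := corrector_sq_facts hω hl.le hβ hγ hN hT ⟨0, hN⟩
  rw [← flip_pairing_eq_kernelMoment hω hl hβ hγ hN hT, integral_flip_mul_eq (pinnedChain ω₂ lam β γ) N T h0m h02]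
  ring

/-! ## §3 The two sectors as graded statements, and the exact split of (C_s) -/

/-- **(Eᶜ_s) `EvenCorrectorGrade s`** — the EVEN-sector grade of the Kubo corrector: `∃ C N₀, ∀ N ≥ N₀,
⟨h₀∘Θ, h₀⟩_{μ_T} = ‖h₀^even‖² − ‖h₀^odd‖² ≤ C·N^s` (larger `s` = WEAKER).  By `flip_pairing_eq_kernelMoment` this is the
FIRST-MOMENT CEILING `∫₀^∞ u·K_N(u) du ≤ C·N^s` of the boundary kernel (`evenCorrectorGrade_iff_kernelMoment`) — a scalar
transport coefficient (the total transient heat drawn from the raised bath in excess of the steady current, `= lim_t (T²/γ)Ov_N(t)`),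
one moment above 11071's `∫₀^∞ K_N`.  Implied by (C_s) and by (U^u_s) (`evenCorrectorGrade_of_correctorGrade`,
`evenCorrectorGrade_of_transientCeilingUniform`); with (Oᶜ_s) EQUIVALENT to (C_s) (`correctorGrade_iff_even_odd`, pure parity algebra).
Why it might fail (`s = 1`): a superdiffusive first moment of `K_N` (mean exit time of the injected energy growing faster than
`N`, e.g. by ballistic phonon channels) — the harmonic member is the borderline case (`∫uK ≍ N`).  Tags: `s = 1` UNDECIDED ·
WEAKER than CCB(3) · even sector · scalar · INSTRUMENTABLE (first moment of the censused `K_N`) · 11071-side only. (piece · ladder)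
[route statement · this cell; NOT a literature fact] -/
def EvenCorrectorGrade (s : ℝ) : Prop :=
  ∀ ω₂ lam β γ : ℝ, 0 < ω₂ → 0 < lam → 0 < β → 0 < γ → ∀ T : ℝ, 0 < T →
    ∃ C : ℝ, ∃ N₀ : ℕ, ∀ (N : ℕ) (hN : 0 < N), N₀ ≤ N →
      ∫ z, kinCorrector ω₂ lam β γ T N ⟨0, hN⟩ (z.1, -z.2) * kinCorrector ω₂ lam β γ T N ⟨0, hN⟩ z
        ∂((pinnedChain ω₂ lam β γ).gibbsMeasure N T) ≤ C * (N : ℝ) ^ s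

/-- **(Oᶜ_s) `OddCorrectorGrade s`** — the ODD-sector grade of the Kubo corrector itself:
`∃ C N₀, ∀ N ≥ N₀, oddDefect(μ_T) h₀ = ∫ (h₀ − h₀∘Θ)² dμ_T = 4‖h₀^odd‖² ≤ C·N^s` (larger `s` = WEAKER).  Implied by (C_s)
(`oddCorrectorGrade_of_correctorGrade`), implies the response-density grade (O_s) `OddSnapshotGrade s`
(`oddSnapshotGrade_of_oddCorrectorGrade`); at `s = 1` EXACTLY the `N`-uniform stub S4o of the 9121 line
(`oddCorrectorBound_of_oddCorrectorGrade_one`, `oddCorrectorGrade_one_of_oddCorrectorBound`).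
Why it might fail (`s = 1`): a `Θ`-odd boundary layer of the linear response that does not delocalise over the chain would
make `‖h₀^odd‖²` superlinear — the same event kills (K) of 9121 [cite: DechantSasa2018, Eq. 4].  Tags: `s = 1` UNDECIDED ·
WEAKER than CCB(3) · the COMMON `N`-uniform leg of 11071 and 9121 · phonon-TRUE. (piece · ladder)
[route statement · this cell; NOT a literature fact] -/
def OddCorrectorGrade (s : ℝ) : Prop :=
  ∀ ω₂ lam β γ : ℝ, 0 < ω₂ → 0 < lam → 0 < β → 0 < γ → ∀ T : ℝ, 0 < T →
    ∃ C : ℝ, ∃ N₀ : ℕ, ∀ (N : ℕ) (hN : 0 < N), N₀ ≤ N →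
      oddDefect ((pinnedChain ω₂ lam β γ).gibbsMeasure N T) (kinCorrector ω₂ lam β γ T N ⟨0, hN⟩) ≤ C * (N : ℝ) ^ s

/-- **(U^u_s) `TransientCeilingUniform s`** — the time-UNIFORM CEILING `∃ C N₀, ∀ N ≥ N₀, ∀ t ≥ 0, Ov_N(t) ≤ C·N^s` of the
escape transient (twin of the tree's floor `TransientFloorUniform s`; larger `s` = WEAKER), in the tree's transient-band
vocabulary.  Sandwiched: (C_s) ⟹ (U^u_s) ⟹ (Eᶜ_s) (`transientCeilingUniform_of_correctorGrade`, `|Ov_N(t)| ≤ (2γ/T²)‖h₀‖²`;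
`evenCorrectorGrade_of_transientCeilingUniform`, the sum rule), so with (Oᶜ_s) it is EQUIVALENT to (C_s) too
(`correctorGrade_iff_parity`); `s = 1` implies the tree's (U) `TransientCeilingPoint` (`transientCeilingPoint_of_uniform`).
Why it might fail (`s = 1`): a transient overshoot of the contact response whose time-integral exceeds the diffusive scale `≍ N`
at SOME time before saturating (sign-indefinite kernels can overshoot their first moment).  Tags: `s = 1` UNDECIDED · WEAKER than
CCB(3) · INSTRUMENTABLE (`Ov_N(t) = W_N(t) − tE_N` from the censused step response) · 11071-side only. (piece · ladder)
[route statement · this cell; NOT a literature fact] -/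
def TransientCeilingUniform (s : ℝ) : Prop :=
  ∀ ω₂ lam β γ : ℝ, 0 < ω₂ → 0 < lam → 0 < β → 0 < γ → ∀ T : ℝ, 0 < T →
    ∃ C : ℝ, ∃ N₀ : ℕ, ∀ N : ℕ, N₀ ≤ N → ∀ t : ℝ, 0 ≤ t →
      escapeTransient ω₂ lam β γ T N t ≤ C * (N : ℝ) ^ s

/-- **(C_s) ⟹ (Eᶜ_s)**: `⟨h₀∘Θ, h₀⟩ = ‖h₀‖² − ½·oddDefect ≤ ‖h₀‖²`. [formal bookkeeping] -/
theorem evenCorrectorGrade_of_correctorGrade {s : ℝ} : CorrectorGrade s → EvenCorrectorGrade s := by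
  intro hC ω₂ lam β γ hω hl hβ hγ T hT
  obtain ⟨C, N₀, hC'⟩ := hC ω₂ lam β γ hω hl hβ hγ T hT
  refine ⟨C, N₀, fun N hN hN₀ => ?_⟩
  obtain ⟨h0m, h02, -, -⟩ := corrector_sq_facts hω hl.le hβ hγ hN hT ⟨0, hN⟩
  rw [integral_flip_mul_eq (pinnedChain ω₂ lam β γ) N T h0m h02]
  linarith [hC' N hN hN₀, oddDefect_nonneg ((pinnedChain ω₂ lam β γ).gibbsMeasure N T) (kinCorrector ω₂ lam β γ T N ⟨0, hN⟩)]

/-- **(C_s) ⟹ (Oᶜ_s)**: `oddDefect(μ_T) h₀ ≤ 4‖h₀‖²` (`oddDefect_le_four_mul`). [formal bookkeeping] -/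
theorem oddCorrectorGrade_of_correctorGrade {s : ℝ} : CorrectorGrade s → OddCorrectorGrade s := by
  intro hC ω₂ lam β γ hω hl hβ hγ T hT
  obtain ⟨C, N₀, hC'⟩ := hC ω₂ lam β γ hω hl hβ hγ T hT
  refine ⟨4 * C, N₀, fun N hN hN₀ => ?_⟩
  obtain ⟨h0m, h02, -, -⟩ := corrector_sq_facts hω hl.le hβ hγ hN hT ⟨0, hN⟩
  calc oddDefect ((pinnedChain ω₂ lam β γ).gibbsMeasure N T) (kinCorrector ω₂ lam β γ T N ⟨0, hN⟩)
      ≤ 4 * ∫ z, kinCorrector ω₂ lam β γ T N ⟨0, hN⟩ z ^ 2 ∂((pinnedChain ω₂ lam β γ).gibbsMeasure N T) :=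
        oddDefect_le_four_mul _ N T h0m h02
    _ ≤ 4 * (C * (N : ℝ) ^ s) := mul_le_mul_of_nonneg_left (hC' N hN hN₀) (by norm_num)
    _ = _ := by ring

/-- ★ **(Eᶜ_s) ∧ (Oᶜ_s) ⟹ (C_s)** — pure parity algebra: `‖h₀‖² = ⟨h₀∘Θ, h₀⟩ + ½·oddDefect ≤ (C₁ + C₂/2)·N^s`. [folklore] -/
theorem correctorGrade_of_even_odd {s : ℝ} : EvenCorrectorGrade s → OddCorrectorGrade s → CorrectorGrade s := by
  intro hE hO ω₂ lam β γ hω hl hβ hγ T hT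
  obtain ⟨C₁, N₁, h₁⟩ := hE ω₂ lam β γ hω hl hβ hγ T hT
  obtain ⟨C₂, N₂, h₂⟩ := hO ω₂ lam β γ hω hl hβ hγ T hT
  refine ⟨C₁ + C₂ / 2, max N₁ N₂, fun N hN hN' => ?_⟩
  have hN₁ : N₁ ≤ N := le_trans (le_max_left _ _) hN'
  have hN₂ : N₂ ≤ N := le_trans (le_max_right _ _) hN'
  obtain ⟨h0m, h02, -, -⟩ := corrector_sq_facts hω hl.le hβ hγ hN hT ⟨0, hN⟩
  have hpar := integral_flip_mul_eq (pinnedChain ω₂ lam β γ) N T h0m h02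
  have he := h₁ N hN hN₁
  have ho := h₂ N hN hN₂
  have e2 : (C₁ + C₂ / 2) * (N : ℝ) ^ s = C₁ * (N : ℝ) ^ s + C₂ * (N : ℝ) ^ s / 2 := by ring
  rw [e2]
  linarith

/-- ★ **THE SPLIT `(C_s) ⟺ (Eᶜ_s) ∧ (Oᶜ_s)`** (every grade `s`; parity algebra alone). [folklore] -/
theorem correctorGrade_iff_even_odd (s : ℝ) : CorrectorGrade s ↔ EvenCorrectorGrade s ∧ OddCorrectorGrade s :=
  ⟨fun h => ⟨evenCorrectorGrade_of_correctorGrade h, oddCorrectorGrade_of_correctorGrade h⟩,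
    fun h => correctorGrade_of_even_odd h.1 h.2⟩

/-- **(C_s) ⟹ (U^u_s)**: `Ov_N(t) ≤ |Ov_N(t)| ≤ (2γ/T²)‖h₀‖²` for every `t ≥ 0` (tree `abs_escapeTransient_le_correctorSq`).
[formal bookkeeping] -/
theorem transientCeilingUniform_of_correctorGrade {s : ℝ} : CorrectorGrade s → TransientCeilingUniform s := by
  intro hC ω₂ lam β γ hω hl hβ hγ T hT
  obtain ⟨C, N₀, hC'⟩ := hC ω₂ lam β γ hω hl hβ hγ T hT
  refine ⟨2 * γ / T ^ 2 * C, max N₀ 1, fun N hN t ht => ?_⟩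
  have hN1 : 1 ≤ N := le_trans (le_max_right _ _) hN
  have hN0 : 0 < N := hN1
  have hN₀ : N₀ ≤ N := le_trans (le_max_left _ _) hN
  calc escapeTransient ω₂ lam β γ T N t ≤ |escapeTransient ω₂ lam β γ T N t| := le_abs_self _
    _ ≤ 2 * γ / T ^ 2 * ∫ z, kinCorrector ω₂ lam β γ T N ⟨0, hN0⟩ z ^ 2 ∂((pinnedChain ω₂ lam β γ).gibbsMeasure N T) :=
        abs_escapeTransient_le_correctorSq hω hl hβ hγ hN0 hT ht
    _ ≤ 2 * γ / T ^ 2 * (C * (N : ℝ) ^ s) := mul_le_mul_of_nonneg_left (hC' N hN0 hN₀) (by positivity)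
    _ = _ := by ring

/-- ★ **(U^u_s) ⟹ (Eᶜ_s)** — the SUM RULE: `(γ/T²)⟨h₀∘Θ, h₀⟩ = lim_t Ov_N(t) ≤ C·N^s` (`flip_pairing_le_of_transient_le`).
[folklore] -/
theorem evenCorrectorGrade_of_transientCeilingUniform {s : ℝ} : TransientCeilingUniform s → EvenCorrectorGrade s := by
  intro hU ω₂ lam β γ hω hl hβ hγ T hT
  obtain ⟨C, N₀, hC⟩ := hU ω₂ lam β γ hω hl hβ hγ T hT
  refine ⟨T ^ 2 / γ * C, N₀, fun N hN hN₀ => ?_⟩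
  set X : ℝ := ∫ z, kinCorrector ω₂ lam β γ T N ⟨0, hN⟩ (z.1, -z.2) * kinCorrector ω₂ lam β γ T N ⟨0, hN⟩ z
    ∂((pinnedChain ω₂ lam β γ).gibbsMeasure N T) with hX
  have hle : γ / T ^ 2 * X ≤ C * (N : ℝ) ^ s :=
    flip_pairing_le_of_transient_le hω hl hβ hγ hN hT fun t ht => hC N hN₀ t ht
  have e : T ^ 2 / γ * (γ / T ^ 2 * X) = X := by field_simp
  calc X = T ^ 2 / γ * (γ / T ^ 2 * X) := e.symm
    _ ≤ T ^ 2 / γ * (C * (N : ℝ) ^ s) := mul_le_mul_of_nonneg_left hle (by positivity)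
    _ = _ := by ring

/-- ★ **(U^u_s) ∧ (Oᶜ_s) ⟹ (C_s)** (sum rule + parity algebra). [folklore] -/
theorem correctorGrade_of_parity {s : ℝ} : TransientCeilingUniform s → OddCorrectorGrade s → CorrectorGrade s :=
  fun hU hO => correctorGrade_of_even_odd (evenCorrectorGrade_of_transientCeilingUniform hU) hO

/-- ★ **THE SPLIT in transient-band vocabulary: `(C_s) ⟺ (U^u_s) ∧ (Oᶜ_s)`** (every grade `s`). [folklore] -/
theorem correctorGrade_iff_parity (s : ℝ) : CorrectorGrade s ↔ TransientCeilingUniform s ∧ OddCorrectorGrade s :=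
  ⟨fun h => ⟨transientCeilingUniform_of_correctorGrade h, oddCorrectorGrade_of_correctorGrade h⟩,
    fun h => correctorGrade_of_parity h.1 h.2⟩

/-- **(U^u_s) ⟺ (Eᶜ_s) given (Oᶜ_s)** — the two even-sector readings coincide on the odd grade. [formal bookkeeping] -/
theorem transientCeilingUniform_iff_evenCorrectorGrade_of_odd {s : ℝ} (hO : OddCorrectorGrade s) :
    TransientCeilingUniform s ↔ EvenCorrectorGrade s :=
  ⟨evenCorrectorGrade_of_transientCeilingUniform,
    fun hE => transientCeilingUniform_of_correctorGrade (correctorGrade_of_even_odd hE hO)⟩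

/-- ★ **CCB(3) ⟺ (E₁ᶜ) ∧ (O₁ᶜ)** — the residual leaf of record `CurrentCorrectorBudget 3` (≡ (C₁), tree
`correctorGrade_one_iff_budget_three`) split by parity. [folklore] -/
theorem currentCorrectorBudget_three_iff_even_odd :
    CurrentCorrectorBudget 3 ↔ EvenCorrectorGrade 1 ∧ OddCorrectorGrade 1 :=
  correctorGrade_one_iff_budget_three.symm.trans (correctorGrade_iff_even_odd 1)

/-- ★ **CCB(3) ⟺ (U^u₁) ∧ (O₁ᶜ)** (transient-band vocabulary). [folklore] -/
theorem currentCorrectorBudget_three_iff_parity :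
    CurrentCorrectorBudget 3 ↔ TransientCeilingUniform 1 ∧ OddCorrectorGrade 1 :=
  correctorGrade_one_iff_budget_three.symm.trans (correctorGrade_iff_parity 1)

/-- **(Eᶜ_s) as a KERNEL-MOMENT ceiling**: `EvenCorrectorGrade s ⟺ ∃ C N₀ ∀ N ≥ N₀ (N ≥ 1), ∫₀^∞ u·K_N(u) du ≤ C·N^s`
(`flip_pairing_eq_kernelMoment`). [formal bookkeeping] -/
theorem evenCorrectorGrade_iff_kernelMoment (s : ℝ) :
    EvenCorrectorGrade s ↔
      ∀ ω₂ lam β γ : ℝ, 0 < ω₂ → 0 < lam → 0 < β → 0 < γ → ∀ T : ℝ, 0 < T →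
        ∃ C : ℝ, ∃ N₀ : ℕ, ∀ N : ℕ, 0 < N → N₀ ≤ N →
          ∫ u in Ioi 0, u * escapeKernel ω₂ lam β γ T N u ≤ C * (N : ℝ) ^ s := by
  constructor
  · intro hE ω₂ lam β γ hω hl hβ hγ T hT
    obtain ⟨C, N₀, hC⟩ := hE ω₂ lam β γ hω hl hβ hγ T hT
    refine ⟨C, N₀, fun N hN hN₀ => ?_⟩
    rw [← flip_pairing_eq_kernelMoment hω hl hβ hγ hN hT]
    exact hC N hN hN₀
  · intro hM ω₂ lam β γ hω hl hβ hγ T hT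
    obtain ⟨C, N₀, hC⟩ := hM ω₂ lam β γ hω hl hβ hγ T hT
    refine ⟨C, N₀, fun N hN hN₀ => ?_⟩
    rw [flip_pairing_eq_kernelMoment hω hl hβ hγ hN hT]
    exact hC N hN hN₀

/-- Grade monotonicity of (Eᶜ_s) (`N ≥ 1`, constant `max C 0`). [formal bookkeeping] -/
theorem evenCorrectorGrade_mono {s s' : ℝ} (hss' : s ≤ s') : EvenCorrectorGrade s → EvenCorrectorGrade s' := by
  intro hE ω₂ lam β γ hω hl hβ hγ T hT
  obtain ⟨C, N₀, hC⟩ := hE ω₂ lam β γ hω hl hβ hγ T hT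
  refine ⟨max C 0, N₀, fun N hN hN₀ => ?_⟩
  have hN1 : (1 : ℝ) ≤ N := by exact_mod_cast hN
  calc ∫ z, kinCorrector ω₂ lam β γ T N ⟨0, hN⟩ (z.1, -z.2) * kinCorrector ω₂ lam β γ T N ⟨0, hN⟩ z
        ∂((pinnedChain ω₂ lam β γ).gibbsMeasure N T)
      ≤ C * (N : ℝ) ^ s := hC N hN hN₀
    _ ≤ max C 0 * (N : ℝ) ^ s := mul_le_mul_of_nonneg_right (le_max_left _ _) (by positivity)
    _ ≤ max C 0 * (N : ℝ) ^ s' :=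
        mul_le_mul_of_nonneg_left (Real.rpow_le_rpow_of_exponent_le hN1 hss') (le_max_right _ _)

/-- Grade monotonicity of (Oᶜ_s) (`N ≥ 1`, constant `max C 0`). [formal bookkeeping] -/
theorem oddCorrectorGrade_mono {s s' : ℝ} (hss' : s ≤ s') : OddCorrectorGrade s → OddCorrectorGrade s' := by
  intro hO ω₂ lam β γ hω hl hβ hγ T hT
  obtain ⟨C, N₀, hC⟩ := hO ω₂ lam β γ hω hl hβ hγ T hT
  refine ⟨max C 0, N₀, fun N hN hN₀ => ?_⟩
  have hN1 : (1 : ℝ) ≤ N := by exact_mod_cast hN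
  calc oddDefect ((pinnedChain ω₂ lam β γ).gibbsMeasure N T) (kinCorrector ω₂ lam β γ T N ⟨0, hN⟩)
      ≤ C * (N : ℝ) ^ s := hC N hN hN₀
    _ ≤ max C 0 * (N : ℝ) ^ s := mul_le_mul_of_nonneg_right (le_max_left _ _) (by positivity)
    _ ≤ max C 0 * (N : ℝ) ^ s' :=
        mul_le_mul_of_nonneg_left (Real.rpow_le_rpow_of_exponent_le hN1 hss') (le_max_right _ _)

/-- Grade monotonicity of (U^u_s) (`N ≥ 1`, constant `max C 0`). [formal bookkeeping] -/
theorem transientCeilingUniform_mono {s s' : ℝ} (hss' : s ≤ s') : TransientCeilingUniform s → TransientCeilingUniform s' := by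
  intro hU ω₂ lam β γ hω hl hβ hγ T hT
  obtain ⟨C, N₀, hC⟩ := hU ω₂ lam β γ hω hl hβ hγ T hT
  refine ⟨max C 0, max N₀ 1, fun N hN t ht => ?_⟩
  have hN1 : (1 : ℝ) ≤ N := by exact_mod_cast le_trans (le_max_right _ _) hN
  have hN₀ : N₀ ≤ N := le_trans (le_max_left _ _) hN
  calc escapeTransient ω₂ lam β γ T N t ≤ C * (N : ℝ) ^ s := hC N hN₀ t ht
    _ ≤ max C 0 * (N : ℝ) ^ s := mul_le_mul_of_nonneg_right (le_max_left _ _) (by positivity)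
    _ ≤ max C 0 * (N : ℝ) ^ s' :=
        mul_le_mul_of_nonneg_left (Real.rpow_le_rpow_of_exponent_le hN1 hss') (le_max_right _ _)

/-- **(U^u₁) ⟹ (U) `TransientCeilingPoint`** (window `c = 1`). [formal bookkeeping] -/
theorem transientCeilingPoint_of_uniform : TransientCeilingUniform 1 → TransientCeilingPoint := by
  intro hU ω₂ lam β γ hω hl hβ hγ T hT
  obtain ⟨C, N₀, hC⟩ := hU ω₂ lam β γ hω hl hβ hγ T hT
  refine ⟨C, 1, one_pos, N₀, fun N hN => ?_⟩
  have h := hC N hN (1 * (N : ℝ) ^ 2) (by positivity)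
  rwa [Real.rpow_one] at h


end ParitySectorSplit

end Summit.AtomisticToContinuum.FouriersLaw.Theorems.BoundedResponse.ParityFloor

end
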